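import Literature.MathematicalPhysics.QuantumFieldTheory.Balaban1983to89.B3Sect3DegreeCensus

/-!
# `Balaban1983to89.B3Sect3ScalarSEDegrees` — T. Bałaban, *(Higgs)₂,₃ quantum fields in a finite volume. III. Renormalization*,
Commun. Math. Phys. **88** (1983) 411–445 [Balaban1983Higgs3]: the degrees of the SELF-ENERGY GRAPHS FOR SCALAR FIELDS — (3.6)
*"(D = −d + 2)"* p. 435, *"All the remaining divergent graphs of this type have degrees equal to 0"* p. 438, and *"the graphs with one
leg differentiated. There are only two such graphs: (3.21)"* p. 438 — DECIDED on the concrete family of graphs `B3Cor23Concrete.Graph`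

statement-level skeleton of published theorems with citation tags; proofs where landed; nothing here is a claim about the Yang–Mills mass gap

PDF held: `paper:balaban1983-higgs-2-3-quantum-fields-finite-volume` (journal page = PDF page + 410); renders read as images:
`…/b2b-balaban-ref1/pages/1983-cmp88-higgs23-III/1983-cmp88-higgs23-III-p025, p028-x2.png` (pp. 435, 438).
CITATION HEADER (lean-in-tree rule).  lit-balaban TYPED SKELETON (HOME `run/shared/lean/pub/lit-balaban/`), Phase 2, seat p18 (gen 3),
unit `lit-balaban-p18`; SKELETON rows **B3.Eq3.6-3.9** (the pictures (3.6) and their tag *"(D = −d + 2)"*), **B3.Eq3.18-3.20** (the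
sentence *"All the remaining divergent graphs of this type have degrees equal to 0"*, p. 438) and **B3.Eq3.21-3.24** (the pictures
(3.21) and *"There are only two such graphs"*), fold owner r15.  Degree formula: `…B3Sect3DegreeCensus` (2·D(G) = budget − 6 in
d = 3); the pictures themselves as graphs of the model: `…B3Sect3LowestOrderGraphs` (`g36a/b/c`, `g321a/b`, `g321Y`).

WHAT THIS MODULE PROVES (d = 3, sorry-free, theorems only; «two external scalar legs only» = two external φ′-legs, no external
A′-leg, no Ã-leg).  (1) `deg_scalarSE`: D(G) ≤ 0 ⇒ D(G) ∈ {0, −1} (−1 = −d + 2); (2) `lowestOrder_scalarSE`: D(G) = −1 iff G is, at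
the level of vertices and incidences, one of the three pictures (3.6) — two vertices (1.8)_{1,0} with one internal φ′-leg (the
differentiated one) and one internal A′-leg each [= (3.8)], or the A′-tadpole at (1.10)_{2,0}, or the φ′-tadpole at (1.6); hence
p. 438: every OTHER divergent graph of this type has D(G) = 0.  (3) `oneLegDifferentiated_scalarSE`: with a differentiation on an
external leg, D(G) ≤ 0 forces D(G) = 0, exactly one external differentiation, and EITHER the one-vertex A′-tadpole at (1.8)_{2,0}
[(3.21) first picture] OR two vertices (1.8)_{1,0}, (1.8)_{1,0} joined by the A′-line with one φ′-line and one internal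
differentiation in all — which is the second picture of (3.21) or ONE MORE configuration not drawn there (the φ′-line returning
to its vertex through the differentiated leg, `B3Sect3LowestOrderGraphs.g321Y`, D = 0): READING NOTE HOME/GAPS.md G-B3-05 (a closed
scalar loop with one power of q, of the kind the paper discards on p. 434 / p. 442; cf. G-B3-03).  NOT here: the analytic
treatment (3.9)–(3.24) (r15 `B3Sect3ScalarSelfEnergy`), Wick ordering (3.7), connectedness / 1PI.
-/

namespace Literature.MathematicalPhysics.QuantumFieldTheory.Balaban1983to89.B3Sect3ScalarSEDegrees

open Finset B3Prop1 B3Sect2Statements B3VertexBridge B3Cor23Concrete B3DivergentGraphs B3ScalarLegParity B3OddVectorLoops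
  B3Sect3DegreeCensus

variable {nbar : ℕ} (G : Graph nbar)

/-- **(3.6)** p. 435 [PDF 25] *"(D = −d + 2)"* and **p. 438** [PDF 28], verbatim: *"Let us consider the other cases of self-energy
graphs for scalar fields. All the remaining divergent graphs of this type have degrees equal to 0."* — PROVED on the model, d = 3:
a graph with D(G) ≤ 0 and two external φ′-legs only (no external A′-leg, no Ã-leg) has D(G) = 0 or D(G) = −1 = −d + 2; the graphs
with D(G) = −1 are identified in `lowestOrder_scalarSE` (they are the three pictures (3.6)). [cite: Balaban1983Higgs3, (3.6) p.435] -/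
theorem deg_scalarSE (hD : G.deg 3 ≤ 0) (hs : numExtScalarLegs G = 2) (hv : numExtVectorLegs G = 0)
    (ht : numTildeLegs G = 0) : G.deg 3 = 0 ∨ G.deg 3 = -1 := by
  have hG := not_hasVertex1315_of_deg_nonpos G hD
  have hb := two_deg_three_eq_budget G hG
  have hb6 := budget_le_six G hD
  have hV := nV_le G hG
  have h1 := one_le_nV G
  have heo := eOrder_eq G
  obtain ⟨k, hk⟩ := even_numIntVectorLegs G
  have hb4 : budget G = 4 ∨ budget G = 6 := by unfold budget at hb6 ⊢; omega
  rcases hb4 with h | h <;> rw [h] at hb <;> push_cast at hb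
  · right; linarith
  · left; linarith

/-- **(3.6)** p. 435 [PDF 25]: the three scalar self-energy graphs of lowest order *"(D = −d + 2)"* — two vertices (1.8)_{1,0}
joined by the φ′-line through both differentiations and by the A′-line; the A′-tadpole at the vertex (1.10)_{2,0}; the
φ′-tadpole at the vertex (1.6) — are ALL the graphs of the model with two external φ′-legs only and D(G) = −1 (d = 3), at the
level of vertices and incidences: PROVED. [cite: Balaban1983Higgs3, (3.6) p.435] -/
theorem lowestOrder_scalarSE (hD : G.deg 3 = -1) (hs : numExtScalarLegs G = 2) (hv : numExtVectorLegs G = 0)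
    (ht : numTildeLegs G = 0) :
    (G.nV = 2 ∧ ∀ i, G.kind i = .v18 1 0 ∧ G.intScalar i = 1 ∧ G.intVector i = 1 ∧ G.intDiffs i = 1) ∨
    (G.nV = 1 ∧ ∀ i, G.kind i = .v110 2 0 ∧ G.intScalar i = 0 ∧ G.intVector i = 2) ∨
    (G.nV = 1 ∧ ∀ i, G.kind i = .v16 ∧ G.intScalar i = 2 ∧ G.intVector i = 0) := by
  have hD' : G.deg 3 ≤ 0 := by rw [hD]; norm_num
  have hG := not_hasVertex1315_of_deg_nonpos G hD'
  have hb : budget G = 4 := by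
    have := two_deg_three_eq_budget G hG
    rw [hD] at this
    have : (budget G : ℚ) = 4 := by linarith
    exact_mod_cast this
  have hV := nV_le G hG
  have h1 := one_le_nV G
  have hsc := two_nV_add_eq G hG
  have heo := eOrder_eq G
  have hvl := sum_vectorLegs_eq G
  obtain ⟨k, hk⟩ := even_numIntVectorLegs G
  unfold budget at hb
  have h17 : numV17 G = 0 := by omega
  by_cases h16 : numV16 G = 1
  · -- the φ′-tadpole at (1.6)
    right; right
    have hiv : numIntVectorLegs G = 0 := by omega
    have hnV : G.nV = 1 := by omega
    refine ⟨hnV, fun i => ?_⟩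
    have hkind : G.kind i = .v16 := by
      have := sum_eq_of_nV_eq_one G hnV i fun j => if G.kind j = .v16 then 1 else 0
      rw [← numV16_eq_sum, h16] at this
      by_contra hc
      simp [hc] at this
    have hS := sum_eq_of_nV_eq_one G hnV i G.intScalar
    have hIV : numIntVectorLegs G = G.intVector i := sum_eq_of_nV_eq_one G hnV i G.intVector
    exact ⟨hkind, by omega, by omega⟩
  · have h16' : numV16 G = 0 := by omega
    have hiv : numIntVectorLegs G = 2 := by omega
    have hX : numExtDiffs G = 0 := by omega
    have hkinds : ∀ i, (∃ n, 1 ≤ n ∧ G.kind i = .v18 n 0) ∨ (∃ n, 2 ≤ n ∧ G.kind i = .v110 n 0) := fun i =>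
      kind_cases_noTilde (G.kind i) (G.adm i) (isOfForm1315_eq_false G hG i) (kind_ne_v16 G h16' i) (kind_ne_v17 G h17 i)
        (extVectorLegs_eq_zero G ht i)
    have hdiff : ∀ i, G.intDiffs i = (G.kind i).diffCount := fun i => by
      have := (sum_eq_zero_iff.mp hX) i (mem_univ i)
      have := G.intDiffs_le i
      omega
    rcases Nat.lt_or_ge G.nV 2 with hlt | hge
    · -- one vertex: the A′-tadpole at (1.10)_{2,0}
      right; left
      have hnV : G.nV = 1 := by omega
      refine ⟨hnV, fun i => ?_⟩
      have hS := sum_eq_of_nV_eq_one G hnV i G.intScalar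
      have hIV : numIntVectorLegs G = G.intVector i := sum_eq_of_nV_eq_one G hnV i G.intVector
      have hVL := sum_eq_of_nV_eq_one G hnV i fun j => (G.kind j).vectorLegs
      have hXi := sum_eq_of_nV_eq_one G hnV i fun j => (G.kind j).diffCount - G.intDiffs j
      rw [← numExtDiffs_eq, hX] at hXi
      have hdi := B3Cor23ConcreteTwoDim.intDiffs_le_intScalar G i
      rcases hkinds i with ⟨n, hn, hk⟩ | ⟨n, hn, hk⟩
      · exfalso
        rw [hk, show (VertexKind.v18 n 0).vectorLegs = n from rfl] at hVL
        rw [hk, show (VertexKind.v18 n 0).diffCount = 1 from rfl] at hXi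
        omega
      · rw [hk, show (VertexKind.v110 n 0).vectorLegs = n from rfl] at hVL
        obtain rfl : n = 2 := by omega
        exact ⟨hk, by omega, by omega⟩
    · -- two vertices (1.8)_{1,0}: the graph (3.8)
      left
      have hnV : G.nV = 2 := by omega
      obtain ⟨i₀, i₁, hne, hall, hsum⟩ := two_vertices G hnV
      refine ⟨hnV, ?_⟩
      have hVL := hsum fun j => (G.kind j).vectorLegs
      have hS := hsum G.intScalar
      have hIV : numIntVectorLegs G = G.intVector i₀ + G.intVector i₁ := hsum G.intVector
      have hv1 : ∀ i, 1 ≤ (G.kind i).vectorLegs := fun i => by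
        rcases hkinds i with ⟨n, hn, hk⟩ | ⟨n, hn, hk⟩ <;> rw [hk] <;> simp [VertexKind.vectorLegs] <;> omega
      have hk18 : ∀ i, G.kind i = .v18 1 0 := by
        intro i
        have hle : (G.kind i).vectorLegs ≤ 1 := by
          have h0 := hv1 i₀; have h1 := hv1 i₁
          rcases hall i with rfl | rfl <;> omega
        rcases hkinds i with ⟨n, hn, hk⟩ | ⟨n, hn, hk⟩ <;> rw [hk] at hle ⊢ <;>
          simp [VertexKind.vectorLegs] at hle ⊢ <;> omega
      intro i
      have hd : G.intDiffs i = 1 := by rw [hdiff i, hk18 i]; rfl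
      have hdi := fun j => B3Cor23ConcreteTwoDim.intDiffs_le_intScalar G j
      have hd0 : G.intDiffs i₀ = 1 := by rw [hdiff i₀, hk18 i₀]; rfl
      have hd1 : G.intDiffs i₁ = 1 := by rw [hdiff i₁, hk18 i₁]; rfl
      have hvle : ∀ j, G.intVector j ≤ 1 := fun j => by have := G.intVector_le j; rw [hk18 j] at this; exact this
      refine ⟨hk18 i, ?_, ?_, hd⟩
      · have := hdi i₀; have := hdi i₁
        rcases hall i with rfl | rfl <;> omega
      · have := hvle i₀; have := hvle i₁
        rcases hall i with rfl | rfl <;> omega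

/-- **p. 438** [PDF 28], verbatim: *"We have to consider another class of graphs with two external scalar field legs, the graphs
with one leg differentiated. There are only two such graphs: (3.21)"* [the A′-tadpole at the vertex (1.8)_{2,0} with its
differentiated φ′-leg external; two vertices (1.8)_{1,0} joined by the A′-line and by a φ′-line carrying ONE of the two
differentiations].  DECIDED on the model, d = 3: a graph with D(G) ≤ 0, two external φ′-legs only and a differentiation acting on
an external leg has D(G) = 0, exactly one external differentiation, and is EITHER the one-vertex graph at (1.8)_{2,0} (both
φ′-legs external, the two A′-legs joined) OR has exactly the two vertices (1.8)_{1,0}, (1.8)_{1,0} joined by the A′-line, with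
one φ′-line in all and one internal differentiation in all — the latter covers the second picture of (3.21) (the φ′-line joins
the differentiated leg of one vertex to the undifferentiated leg of the other) AND one further configuration not drawn in
(3.21): the φ′-line returning to the same vertex (a φ′-tadpole through the differentiated leg; a closed scalar loop with one
power of q, of the kind the paper discards on p. 434/p. 442).  See `…B3Sect3LowestOrderGraphs` for the three model graphs and
HOME/GAPS.md G-B3-05 (reading note). [cite: Balaban1983Higgs3, (3.21) p.438] -/
theorem oneLegDifferentiated_scalarSE (hD : G.deg 3 ≤ 0) (hs : numExtScalarLegs G = 2) (hv : numExtVectorLegs G = 0)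
    (ht : numTildeLegs G = 0) (hX : 1 ≤ numExtDiffs G) :
    G.deg 3 = 0 ∧ numExtDiffs G = 1 ∧
      ((G.nV = 1 ∧ ∀ i, G.kind i = .v18 2 0 ∧ G.intScalar i = 0 ∧ G.intVector i = 2 ∧ G.intDiffs i = 0) ∨
       (G.nV = 2 ∧ (∀ i, G.kind i = .v18 1 0 ∧ G.intVector i = 1) ∧ ∑ i, G.intScalar i = 2 ∧ ∑ i, G.intDiffs i = 1)) := by
  have hG := not_hasVertex1315_of_deg_nonpos G hD
  have hb := two_deg_three_eq_budget G hG
  have hb6 := budget_le_six G hD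
  have hV := nV_le G hG
  have h1 := one_le_nV G
  have hsc := two_nV_add_eq G hG
  have heo := eOrder_eq G
  have hvl := sum_vectorLegs_eq G
  obtain ⟨k, hk⟩ := even_numIntVectorLegs G
  unfold budget at hb6 hb
  have h17 : numV17 G = 0 := by omega
  have hX1 : numExtDiffs G = 1 := by omega
  -- no vertex (1.6): it would be alone and carries no differentiation
  have h16 : numV16 G = 0 := by
    by_contra h16
    have h16' : numV16 G = 1 := by omega
    have hnV : G.nV = 1 := by omega
    obtain ⟨⟨i₀, -⟩, -⟩ := G.exists_line
    have hkind : G.kind i₀ = .v16 := by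
      have := sum_eq_of_nV_eq_one G hnV i₀ fun j => if G.kind j = .v16 then 1 else 0
      rw [← numV16_eq_sum, h16'] at this
      by_contra hc
      simp [hc] at this
    have hXi := sum_eq_of_nV_eq_one G hnV i₀ fun j => (G.kind j).diffCount - G.intDiffs j
    rw [← numExtDiffs_eq, hX1, hkind, show VertexKind.v16.diffCount = 0 from rfl] at hXi
    omega
  have hiv : numIntVectorLegs G = 2 := by omega
  have hdeg : G.deg 3 = 0 := by
    have : (budget G : ℚ) = 6 := by unfold budget; push_cast; rw [hiv, hv, ht, h16, h17, hs, hX1]; norm_num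
    unfold budget at this; linarith
  refine ⟨hdeg, hX1, ?_⟩
  have hkinds : ∀ i, (∃ n, 1 ≤ n ∧ G.kind i = .v18 n 0) ∨ (∃ n, 2 ≤ n ∧ G.kind i = .v110 n 0) := fun i =>
    kind_cases_noTilde (G.kind i) (G.adm i) (isOfForm1315_eq_false G hG i) (kind_ne_v16 G h16 i) (kind_ne_v17 G h17 i)
      (extVectorLegs_eq_zero G ht i)
  rcases Nat.lt_or_ge G.nV 2 with hlt | hge
  · -- one vertex: the A′-tadpole at (1.8)_{2,0}
    left
    have hnV : G.nV = 1 := by omega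
    refine ⟨hnV, fun i => ?_⟩
    have hS := sum_eq_of_nV_eq_one G hnV i G.intScalar
    have hIV : numIntVectorLegs G = G.intVector i := sum_eq_of_nV_eq_one G hnV i G.intVector
    have hVL := sum_eq_of_nV_eq_one G hnV i fun j => (G.kind j).vectorLegs
    have hXi := sum_eq_of_nV_eq_one G hnV i fun j => (G.kind j).diffCount - G.intDiffs j
    rw [← numExtDiffs_eq, hX1] at hXi
    have hdi := B3Cor23ConcreteTwoDim.intDiffs_le_intScalar G i
    rcases hkinds i with ⟨n, hn, hk'⟩ | ⟨n, hn, hk'⟩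
    · rw [hk', show (VertexKind.v18 n 0).vectorLegs = n from rfl] at hVL
      obtain rfl : n = 2 := by omega
      exact ⟨hk', by omega, by omega, by omega⟩
    · exfalso
      rw [hk', show (VertexKind.v110 n 0).diffCount = 0 from rfl] at hXi
      omega
  · -- two vertices (1.8)_{1,0}
    right
    have hnV : G.nV = 2 := by omega
    obtain ⟨i₀, i₁, hne, hall, hsum⟩ := two_vertices G hnV
    have hVL := hsum fun j => (G.kind j).vectorLegs
    have hS := hsum G.intScalar
    have hIV : numIntVectorLegs G = G.intVector i₀ + G.intVector i₁ := hsum G.intVector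
    have hv1 : ∀ i, 1 ≤ (G.kind i).vectorLegs := fun i => by
      rcases hkinds i with ⟨n, hn, hk'⟩ | ⟨n, hn, hk'⟩ <;> rw [hk'] <;> simp [VertexKind.vectorLegs] <;> omega
    have hk18 : ∀ i, G.kind i = .v18 1 0 := by
      intro i
      have hle : (G.kind i).vectorLegs ≤ 1 := by
        have h0 := hv1 i₀; have h1 := hv1 i₁
        rcases hall i with rfl | rfl <;> omega
      rcases hkinds i with ⟨n, hn, hk'⟩ | ⟨n, hn, hk'⟩ <;> rw [hk'] at hle ⊢ <;>
        simp [VertexKind.vectorLegs] at hle ⊢ <;> omega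
    have hvle : ∀ j, G.intVector j ≤ 1 := fun j => by have := G.intVector_le j; rw [hk18 j] at this; exact this
    have hXsum := hsum fun j => (G.kind j).diffCount - G.intDiffs j
    rw [← numExtDiffs_eq, hX1, hk18 i₀, hk18 i₁, show (VertexKind.v18 1 0).diffCount = 1 from rfl] at hXsum
    have hd0 := G.intDiffs_le i₀; have hd1 := G.intDiffs_le i₁
    rw [hk18 i₀] at hd0; rw [hk18 i₁] at hd1
    change G.intDiffs _ ≤ 1 at hd0 hd1
    refine ⟨hnV, fun i => ⟨hk18 i, ?_⟩, by omega, ?_⟩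
    · have := hvle i₀; have := hvle i₁
      rcases hall i with rfl | rfl <;> omega
    · rw [hsum G.intDiffs]; omega

/-! ## v1.1 (same seat): the printed order windows «2 ≤ α + 2β ≤ 4» (1.23) p. 417 and «2 ≤ α + 2β ≤ 6» (1.24) p. 418 -/

/-- **pp. 417–418** [PDF 7–8], the LOWER ends of the printed order windows *"δm² = Σ_{2≤α+2β≤4} e^αλ^βδm²_{(α,β)}"* (1.23) and
*"2 ≤ α + 2β ≤ 6"* (1.24): on the model, a graph without external A′-legs, without Ã-legs (the graphs of Σ_ε and the vacuum
graphs alike) and without vertices (1.13)–(1.15) has EVEN order α + 2β ≥ 2 — its e-order α is then the number of internal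
A′-legs (`eOrder_eq`), which come in pairs (`even_numIntVectorLegs`), and the graph has a vertex, each vertex contributing to α or
to β (`nV_le`; β = #(1.6), a vertex (1.7) counted with order 2 as in `deg_pos_of_order_gt_four`).
[cite: Balaban1983Higgs3, (1.23) p.417] -/
theorem two_le_order (hG : ¬ G.HasVertex1315) (hv : numExtVectorLegs G = 0) (ht : numTildeLegs G = 0) :
    2 ≤ eOrder G + 2 * numV16 G + 2 * numV17 G ∧ Even (eOrder G + 2 * numV16 G + 2 * numV17 G) := by
  have hV := nV_le G hG
  have h1 := one_le_nV G
  obtain ⟨k, hk⟩ := even_numIntVectorLegs G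
  have he := eOrder_eq G
  rw [hv, ht] at he
  exact ⟨by omega, ⟨k + numV16 G + numV17 G, by omega⟩⟩

/-- **pp. 417–418**: the two printed windows for the graphs that have to be renormalized (D(G) ≤ 0, d = 3; such a graph has no
vertex (1.13)–(1.15), Cor. 2.3): a divergent graph of Σ_ε (two external φ′-legs only) has 2 ≤ α + 2β ≤ 4, a divergent vacuum graph
has 2 ≤ α + 2β ≤ 6 — the upper ends are `…B3Sect3DegreeCensus.deg_pos_of_order_gt_four` / `deg_pos_of_order_gt_six`.
[cite: Balaban1983Higgs3, (1.24) p.418] -/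
theorem order_window_of_deg_nonpos (hD : G.deg 3 ≤ 0) (hv : numExtVectorLegs G = 0) (ht : numTildeLegs G = 0) :
    (numExtScalarLegs G = 2 → 2 ≤ eOrder G + 2 * numV16 G + 2 * numV17 G ∧ eOrder G + 2 * numV16 G + 2 * numV17 G ≤ 4) ∧
    (numExtScalarLegs G = 0 → 2 ≤ eOrder G + 2 * numV16 G + 2 * numV17 G ∧ eOrder G + 2 * numV16 G + 2 * numV17 G ≤ 6) := by
  have h2 := (two_le_order G (not_hasVertex1315_of_deg_nonpos G hD) hv ht).1
  refine ⟨fun hs => ⟨h2, ?_⟩, fun hs => ⟨h2, ?_⟩⟩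
  · by_contra h
    exact absurd hD (not_le.mpr (deg_pos_of_order_gt_four G hs hv ht (by omega)))
  · by_contra h
    exact absurd hD (not_le.mpr (deg_pos_of_order_gt_six G hs hv ht (by omega)))

end Literature.MathematicalPhysics.QuantumFieldTheory.Balaban1983to89.B3Sect3ScalarSEDegrees
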